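import Literature.NumberTheory.LFunctions.KloostermanFractionsSquarefull
import Literature.NumberTheory.LFunctions.KloostermanFractionsWeilPair
import HarnessLib

/-!
# Bilinear forms with Kloosterman fractions: tools for Bettin–Chandee §6, second half

Topic `NumberTheory/LFunctions`.  S. Bettin, V. Chandee, *Trilinear forms with Kloosterman
fractions*, Adv. Math. 328 (2018), §6: with `𝓒₁ ≪ M^ε ∑_{b squarefull} b^{1/2} 𝓒_b(M, N/b; β_b)`
(`KloostermanFractionsSquarefull.lean`), "if `b ≤ B`, we apply (5.2) … For `b > B` we apply the
trivial bound `𝓒_b(M,N/b) ≪ (MN/b)‖β_b‖²` … We choose `B = N^{1/2}`".  This file PROVES the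
ingredients (single numerator `A = 1`, `ϑ = k`, second moments with `m ∼ M`, i.e.
`m ∈ (⌊M⌋, ⌊2M⌋]`, written with the tree's `kfInner`); the assembly to (6.4) and to the named fact
`DukeFriedlanderIwaniec1997_bilinearKloostermanFractions` is `KloostermanFractionsFromCb.lean`.

* `kfCI_trivial_bound` — `∑_{M<m≤2M,(m,b)=1} |kfInner k b N' γ m|² ≤ 4MN'‖γ‖²`; `kfInner_eq_zero_of_forall`;
* `BC_second_moment_le_sqfull_gen`, `BC_C1I_le_sum_sqfull` — the squarefull decomposition of
  `KloostermanFractionsSquarefull.lean` for an arbitrary set of `m`, resp. `m ∈ (⌊M⌋, ⌊2M⌋]`;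
* `sum_sqfull_normSq_betab_eq` — `∑_b ‖β_b‖² = ‖β‖²` (`β_b(n') = μ²(n')[(n',b)=1] β_{bn'}`);
* `BC_terms52_le` — the exponents of (5.2) at `N' = N/b` times `b^{1/2}`, `1 ≤ b ≤ N^{1/2}` ((6.1));
  `BC_terms6_absorb` — the absorptions "`M^{6/5}N^{1/10} ≪ MN^{3/4}` if `M ≪ N²`",
  `M^{1/2}N^{5/4} ≪ MN^{3/4} + N^{7/4}` (for `M ≤ 4N²`);
* **`BC_sqrtb_Cb_le`** — one squarefull `b`: from (5.2) (as a hypothesis, see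
  `KloostermanFractionsFromCb.lean`) for `b ≤ N^{1/2}` and the trivial bound for `b > N^{1/2}`,
  `b^{1/2} 𝓒_b(M, N/b; γ) ≤ ‖γ‖² (K(MN(1+|k|))^ε(1+|k|/MN)^{1/2} T₆ + 4MN^{3/4})`.

## References

* S. Bettin, V. Chandee, Adv. Math. 328 (2018) 1234–1262 (arXiv:1502.00769), §6 ((6.1), (6.2)).
  [BettinChandee2018]
* W. Duke, J. Friedlander, H. Iwaniec, Invent. Math. 128 (1997) 23–43. [DukeFriedlanderIwaniec1997]
-/

noncomputable section

open Finset Real Complex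

namespace Literature.NumberTheory.LFunctions

/-! ### The second moments with `m ∼ M` -/

/-- **Trivial bound** for the amplification-free second moment with `m ∈ (⌊M⌋, ⌊2M⌋]`, `(m,b)=1`:
`∑_m |kfInner k b N' γ m|² ≤ 4 M N' ‖γ‖²` (`M, N' ≥ 0`; at most `2M` values of `m`, and
`|∑_{n'} γ φ|² ≤ 2N' ‖γ‖²` by Cauchy–Schwarz; Bettin–Chandee §6: "`𝓒_b ≪ A (MN/b) ‖β_b‖²`").
[cite: BettinChandee2018, §6] -/
theorem kfCI_trivial_bound (k : ℤ) (b : ℕ) {M N' : ℝ} (hM : 0 ≤ M) (hN' : 0 ≤ N') (γ : ℕ → ℂ) :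
    ∑ m ∈ (Ioc ⌊M⌋₊ ⌊2 * M⌋₊).filter (fun m => m.Coprime b), ‖kfInner k b N' γ m‖ ^ 2 ≤
      4 * M * N' * ∑ n ∈ Icc 1 ⌊2 * N'⌋₊, ‖γ n‖ ^ 2 := by
  set nγ2 : ℝ := ∑ n ∈ Icc 1 ⌊2 * N'⌋₊, ‖γ n‖ ^ 2 with hnγ2
  have hnγ0 : 0 ≤ nγ2 := Finset.sum_nonneg fun _ _ => sq_nonneg _
  have hcardN : ((Icc 1 ⌊2 * N'⌋₊).card : ℝ) ≤ 2 * N' := by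
    rw [Nat.card_Icc]; simpa using Nat.floor_le (by positivity : (0 : ℝ) ≤ 2 * N')
  have hcardM : (((Ioc ⌊M⌋₊ ⌊2 * M⌋₊).filter (fun m => m.Coprime b)).card : ℝ) ≤ 2 * M := by
    calc (((Ioc ⌊M⌋₊ ⌊2 * M⌋₊).filter (fun m => m.Coprime b)).card : ℝ)
        ≤ ((Ioc ⌊M⌋₊ ⌊2 * M⌋₊).card : ℝ) := by exact_mod_cast Finset.card_filter_le _ _
      _ = ((⌊2 * M⌋₊ - ⌊M⌋₊ : ℕ) : ℝ) := by rw [Nat.card_Ioc]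
      _ ≤ (⌊2 * M⌋₊ : ℝ) := by exact_mod_cast Nat.sub_le _ _
      _ ≤ 2 * M := Nat.floor_le (by positivity)
  have hinner : ∀ m : ℕ, ‖kfInner k b N' γ m‖ ^ 2 ≤ 2 * N' * nγ2 := by
    intro m
    unfold kfInner kfCoeff
    have h1 : ‖∑ n ∈ (Icc 1 ⌊2 * N'⌋₊).filter (fun n => n.Coprime m), γ n * kfPhase k (b * n) m‖ ≤
        ∑ n ∈ Icc 1 ⌊2 * N'⌋₊, ‖γ n‖ := by
      refine (norm_sum_le _ _).trans ?_
      calc ∑ n ∈ (Icc 1 ⌊2 * N'⌋₊).filter (fun n => n.Coprime m), ‖γ n * kfPhase k (b * n) m‖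
          ≤ ∑ n ∈ Icc 1 ⌊2 * N'⌋₊, ‖γ n * kfPhase k (b * n) m‖ :=
            Finset.sum_le_sum_of_subset_of_nonneg (Finset.filter_subset _ _) fun _ _ _ => norm_nonneg _
        _ = ∑ n ∈ Icc 1 ⌊2 * N'⌋₊, ‖γ n‖ :=
            Finset.sum_congr rfl fun n _ => by rw [norm_mul, DFI_norm_kfPhase, mul_one]
    have h2 : (∑ n ∈ Icc 1 ⌊2 * N'⌋₊, ‖γ n‖) ^ 2 ≤ 2 * N' * nγ2 :=
      sq_sum_le_card_mul_sum_sq.trans (mul_le_mul_of_nonneg_right hcardN hnγ0)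
    calc ‖∑ n ∈ (Icc 1 ⌊2 * N'⌋₊).filter (fun n => n.Coprime m), γ n * kfPhase k (b * n) m‖ ^ 2
        ≤ (∑ n ∈ Icc 1 ⌊2 * N'⌋₊, ‖γ n‖) ^ 2 := pow_le_pow_left₀ (norm_nonneg _) h1 2
      _ ≤ 2 * N' * nγ2 := h2
  calc ∑ m ∈ (Ioc ⌊M⌋₊ ⌊2 * M⌋₊).filter (fun m => m.Coprime b), ‖kfInner k b N' γ m‖ ^ 2
      ≤ ∑ m ∈ (Ioc ⌊M⌋₊ ⌊2 * M⌋₊).filter (fun m => m.Coprime b), 2 * N' * nγ2 :=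
        Finset.sum_le_sum fun m _ => hinner m
    _ = (((Ioc ⌊M⌋₊ ⌊2 * M⌋₊).filter (fun m => m.Coprime b)).card : ℝ) * (2 * N' * nγ2) := by
        rw [Finset.sum_const, nsmul_eq_mul]
    _ ≤ (2 * M) * (2 * N' * nγ2) := by
        have : 0 ≤ 2 * N' * nγ2 := by positivity
        exact mul_le_mul_of_nonneg_right hcardM this
    _ = 4 * M * N' * nγ2 := by ring

/-- `kfInner k b N' γ m = 0` when `γ` vanishes on the box `1 ≤ n ≤ 2N'`. [folklore] -/
theorem kfInner_eq_zero_of_forall (k : ℤ) (b : ℕ) (N' : ℝ) {γ : ℕ → ℂ}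
    (h : ∀ n ∈ Icc 1 ⌊2 * N'⌋₊, γ n = 0) (m : ℕ) : kfInner k b N' γ m = 0 := by
  unfold kfInner kfCoeff
  refine Finset.sum_eq_zero fun n hn => ?_
  rw [h n (Finset.mem_filter.mp hn).1, zero_mul]

/-- **Bettin–Chandee §6 for a second moment over an arbitrary set of `m`** (as
`BC_second_moment_le_sqfull` of `KloostermanFractionsSquarefull.lean`, whose `m`-range is `[1, Y]`;
the proof is identical): for any finite set `Sm` of `m`, any `β` and phase `φ`,
`∑_{m ∈ Sm} |∑_{n ≤ X,(m,n)=1} β_n φ(m,n)|² ≤ Z(X) ∑_{b sqfull} b^{1/2} ∑_{m ∈ Sm,(m,b)=1} |∑_{n' ≤ X/b,(n',m)=1} β_b(n') φ(m,bn')|²`.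
[cite: BettinChandee2018, §6] -/
theorem BC_second_moment_le_sqfull_gen (Sm : Finset ℕ) (X : ℕ) (β : ℕ → ℂ) (φ : ℕ → ℕ → ℂ) :
    ∑ m ∈ Sm, ‖∑ n ∈ Icc 1 X, (if m.Coprime n then β n * φ m n else 0)‖ ^ 2 ≤
      (∑ b ∈ (Icc 1 X).filter (fun b => ∀ p ∈ b.primeFactors, p ^ 2 ∣ b), (Real.sqrt b)⁻¹) *
        ∑ b ∈ (Icc 1 X).filter (fun b => ∀ p ∈ b.primeFactors, p ^ 2 ∣ b),
          Real.sqrt b * ∑ m ∈ Sm.filter (fun m => m.Coprime b),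
            ‖∑ n' ∈ (Icc 1 (X / b)).filter (fun n' => n'.Coprime m),
              (if Squarefree n' ∧ n'.Coprime b then β (b * n') else 0) * φ m (b * n')‖ ^ 2 := by
  set SF := (Icc 1 X).filter (fun b => ∀ p ∈ b.primeFactors, p ^ 2 ∣ b) with hSF
  set Z : ℝ := ∑ b ∈ SF, (Real.sqrt b)⁻¹ with hZ
  have hm : ∀ m : ℕ, ‖∑ n ∈ Icc 1 X, (if m.Coprime n then β n * φ m n else 0)‖ ^ 2 ≤
      Z * ∑ b ∈ SF, Real.sqrt b *
        ‖∑ n' ∈ (Icc 1 (X / b)).filter (fun n' => Squarefree n' ∧ n'.Coprime b),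
          (if m.Coprime (b * n') then β (b * n') * φ m (b * n') else 0)‖ ^ 2 :=
    fun m => BC_norm_sum_sq_le_sqfull X (fun n => if m.Coprime n then β n * φ m n else 0)
  have hinner : ∀ b ∈ SF, ∀ m : ℕ,
      (∑ n' ∈ (Icc 1 (X / b)).filter (fun n' => Squarefree n' ∧ n'.Coprime b),
          (if m.Coprime (b * n') then β (b * n') * φ m (b * n') else 0)) =
        if m.Coprime b then
          ∑ n' ∈ (Icc 1 (X / b)).filter (fun n' => n'.Coprime m),
            (if Squarefree n' ∧ n'.Coprime b then β (b * n') else 0) * φ m (b * n')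
        else 0 := by
    intro b _ m
    by_cases hmb : m.Coprime b
    · rw [if_pos hmb, Finset.sum_filter, Finset.sum_filter]
      refine Finset.sum_congr rfl fun n' _ => ?_
      by_cases h1 : Squarefree n' ∧ n'.Coprime b
      · rw [if_pos h1, if_pos h1]
        by_cases h2 : n'.Coprime m
        · rw [if_pos h2, if_pos (Nat.Coprime.mul_right hmb h2.symm)]
        · rw [if_neg h2, if_neg (fun h => h2 (Nat.Coprime.coprime_mul_left_right h).symm)]
      · rw [if_neg h1, if_neg h1]
        split_ifs <;> simp
    · rw [if_neg hmb]
      refine Finset.sum_eq_zero fun n' _ => ?_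
      rw [if_neg (fun h => hmb (Nat.Coprime.coprime_mul_right_right h))]
  calc ∑ m ∈ Sm, ‖∑ n ∈ Icc 1 X, (if m.Coprime n then β n * φ m n else 0)‖ ^ 2
      ≤ ∑ m ∈ Sm, Z * ∑ b ∈ SF, Real.sqrt b *
          ‖∑ n' ∈ (Icc 1 (X / b)).filter (fun n' => Squarefree n' ∧ n'.Coprime b),
            (if m.Coprime (b * n') then β (b * n') * φ m (b * n') else 0)‖ ^ 2 :=
        Finset.sum_le_sum fun m _ => hm m
    _ = Z * ∑ b ∈ SF, Real.sqrt b * ∑ m ∈ Sm,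
          ‖∑ n' ∈ (Icc 1 (X / b)).filter (fun n' => Squarefree n' ∧ n'.Coprime b),
            (if m.Coprime (b * n') then β (b * n') * φ m (b * n') else 0)‖ ^ 2 := by
        rw [← Finset.mul_sum, Finset.sum_comm]
        congr 1
        refine Finset.sum_congr rfl fun b _ => ?_
        rw [Finset.mul_sum]
    _ = Z * ∑ b ∈ SF, Real.sqrt b * ∑ m ∈ Sm.filter (fun m => m.Coprime b),
          ‖∑ n' ∈ (Icc 1 (X / b)).filter (fun n' => n'.Coprime m),
            (if Squarefree n' ∧ n'.Coprime b then β (b * n') else 0) * φ m (b * n')‖ ^ 2 := by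
        congr 1
        refine Finset.sum_congr rfl fun b hb => ?_
        congr 1
        rw [Finset.sum_filter]
        refine Finset.sum_congr rfl fun m _ => ?_
        rw [hinner b hb m]
        split_ifs <;> simp

/-- **`𝓒₁ ≤ Z · ∑_b b^{1/2} 𝓒_b(M, N/b; β_b)` with `m ∼ M`** (`m ∈ (⌊M⌋, ⌊2M⌋]`), the `𝓒_b` written
with the tree's `kfInner`:
`∑_{M<m≤2M} |∑_{n ≤ 2N,(m,n)=1} β_n e(k m̄/n)|² ≤ Z(⌊2N⌋) ∑_{b ≤ 2N sqfull} b^{1/2} ∑_{M<m≤2M,(m,b)=1} |kfInner k b (N/b) β_b m|²`.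
[cite: BettinChandee2018, §6] -/
theorem BC_C1I_le_sum_sqfull (k : ℤ) (M N : ℝ) (β : ℕ → ℂ) :
    ∑ m ∈ Ioc ⌊M⌋₊ ⌊2 * M⌋₊, ‖∑ n ∈ Icc 1 ⌊2 * N⌋₊,
        (if m.Coprime n then
          β n * Complex.exp (2 * Real.pi * Complex.I *
            ((k : ℂ) * ((((m : ZMod n)⁻¹).val : ℕ) : ℂ) / (n : ℂ)))
        else 0)‖ ^ 2 ≤
      (∑ b ∈ (Icc 1 ⌊2 * N⌋₊).filter (fun b => ∀ p ∈ b.primeFactors, p ^ 2 ∣ b), (Real.sqrt b)⁻¹) *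
        ∑ b ∈ (Icc 1 ⌊2 * N⌋₊).filter (fun b => ∀ p ∈ b.primeFactors, p ^ 2 ∣ b),
          Real.sqrt b * ∑ m ∈ (Ioc ⌊M⌋₊ ⌊2 * M⌋₊).filter (fun m => m.Coprime b),
            ‖kfInner k b (N / b) (fun n' => if Squarefree n' ∧ n'.Coprime b then β (b * n') else 0) m‖ ^ 2 := by
  have h := BC_second_moment_le_sqfull_gen (Ioc ⌊M⌋₊ ⌊2 * M⌋₊) ⌊2 * N⌋₊ β (fun m n => kfPhase k n m)
  have hfl : ∀ b : ℕ, ⌊2 * (N / b)⌋₊ = ⌊2 * N⌋₊ / b := fun b => by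
    rw [show (2 : ℝ) * (N / b) = 2 * N / b by ring, Nat.floor_div_natCast]
  refine (le_of_eq rfl).trans (h.trans (le_of_eq ?_))
  congr 1
  refine Finset.sum_congr rfl fun b _ => ?_
  congr 1
  refine Finset.sum_congr rfl fun m _ => ?_
  unfold kfInner kfCoeff
  rw [hfl b]

/-- **`∑_b ‖β_b‖² = ‖β‖²`**: the coefficient sequences `β_b(n') = μ²(n')[(n',b)=1] β_{bn'}` over the
squarefull `b ≤ X` partition `β` on `1 ≤ n ≤ X` (`n = b n'` uniquely). [cite: BettinChandee2018, §6] -/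
theorem sum_sqfull_normSq_betab_eq (X : ℕ) (β : ℕ → ℂ) :
    ∑ b ∈ (Icc 1 X).filter (fun b => ∀ p ∈ b.primeFactors, p ^ 2 ∣ b),
        ∑ n' ∈ Icc 1 (X / b), ‖(if Squarefree n' ∧ n'.Coprime b then β (b * n') else 0)‖ ^ 2 =
      ∑ n ∈ Icc 1 X, ‖β n‖ ^ 2 := by
  rw [sum_Icc_eq_sum_sqfullPart_fiber X (fun n => ‖β n‖ ^ 2)]
  refine Finset.sum_congr rfl fun b hb => ?_
  rw [Finset.mem_filter, Finset.mem_Icc] at hb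
  rw [sum_sqfullPart_fiber_eq X hb.1.1 hb.2 (fun n => ‖β n‖ ^ 2), Finset.sum_filter]
  refine Finset.sum_congr rfl fun n' _ => ?_
  split_ifs <;> simp

/-! ### The exponents of (5.2) at `N' = N/b`, and the absorptions of §6 -/

/-- **(5.2) at `N' = N/b`, times `b^{1/2}`** (Bettin–Chandee (6.1)): for `M, N > 0` and
`1 ≤ b ≤ N^{1/2}`,
`b^{1/2} (M(bN')^{1/2} + b^{3/4}M^{1/2}N'^{5/4} + M^{6/5}N'^{1/10}b^{-2/5} + b^{1/5}M^{6/5}N'^{7/10} + b^{1/2}M^{3/5}N'^{13/10} + b^{1/2}N'^{7/4})`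
`≤ MN^{3/4} + M^{1/2}N^{5/4} + M^{6/5}N^{1/10} + M^{6/5}N^{7/10} + M^{3/5}N^{13/10} + N^{7/4}`, `N' = N/b`.
[cite: BettinChandee2018, §6 (6.1)] -/
theorem BC_terms52_le {M N b : ℝ} (hM : 0 < M) (hN : 0 < N) (hb1 : 1 ≤ b) (hbN : b ≤ N ^ (1 / 2 : ℝ)) :
    Real.sqrt b * (M * (b * (N / b)) ^ (1 / 2 : ℝ) + b ^ (3 / 4 : ℝ) * M ^ (1 / 2 : ℝ) * (N / b) ^ (5 / 4 : ℝ) +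
        M ^ (6 / 5 : ℝ) * (N / b) ^ (1 / 10 : ℝ) * b ^ (-(2 / 5) : ℝ) +
        b ^ (1 / 5 : ℝ) * M ^ (6 / 5 : ℝ) * (N / b) ^ (7 / 10 : ℝ) +
        b ^ (1 / 2 : ℝ) * M ^ (3 / 5 : ℝ) * (N / b) ^ (13 / 10 : ℝ) + b ^ (1 / 2 : ℝ) * (N / b) ^ (7 / 4 : ℝ)) ≤
      M * N ^ (3 / 4 : ℝ) + M ^ (1 / 2 : ℝ) * N ^ (5 / 4 : ℝ) + M ^ (6 / 5 : ℝ) * N ^ (1 / 10 : ℝ) +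
        M ^ (6 / 5 : ℝ) * N ^ (7 / 10 : ℝ) + M ^ (3 / 5 : ℝ) * N ^ (13 / 10 : ℝ) + N ^ (7 / 4 : ℝ) := by
  have hb : 0 < b := by linarith
  have hNb : 0 < N / b := div_pos hN hb
  obtain ⟨a, ha⟩ : ∃ a : ℝ, a = Real.log M := ⟨_, rfl⟩
  obtain ⟨n, hn⟩ : ∃ n : ℝ, n = Real.log N := ⟨_, rfl⟩
  obtain ⟨l, hl⟩ : ∃ l : ℝ, l = Real.log b := ⟨_, rfl⟩
  have hl0 : 0 ≤ l := hl ▸ Real.log_nonneg hb1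
  have hln : l ≤ 1 / 2 * n := by
    have h1 : Real.log b ≤ Real.log (N ^ (1 / 2 : ℝ)) := Real.log_le_log hb hbN
    rw [Real.log_rpow hN, ← hl, ← hn] at h1
    exact h1
  have eM : ∀ c : ℝ, M ^ c = Real.exp (c * a) := fun c => by
    rw [Real.rpow_def_of_pos hM, mul_comm, ha]
  have eN : ∀ c : ℝ, N ^ c = Real.exp (c * n) := fun c => by
    rw [Real.rpow_def_of_pos hN, mul_comm, hn]
  have eb : ∀ c : ℝ, b ^ c = Real.exp (c * l) := fun c => by
    rw [Real.rpow_def_of_pos hb, mul_comm, hl]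
  have eNb : ∀ c : ℝ, (N / b) ^ c = Real.exp (c * (n - l)) := fun c => by
    rw [Real.rpow_def_of_pos hNb, Real.log_div hN.ne' hb.ne', mul_comm, hn, hl]
  have esb : Real.sqrt b = Real.exp (1 / 2 * l) := by rw [Real.sqrt_eq_rpow, eb]
  have ebNb : (b * (N / b)) ^ (1 / 2 : ℝ) = Real.exp (1 / 2 * n) := by
    rw [mul_div_cancel₀ _ hb.ne', eN]
  simp only [esb, ebNb, eb, eM, eN, eNb]
  -- everything is now a sum of exponentials (times `M` in the first term); compare termwise
  have t1 : Real.exp (1 / 2 * l) * (M * Real.exp (1 / 2 * n)) ≤ M * Real.exp (3 / 4 * n) := by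
    have h : Real.exp (1 / 2 * l) * Real.exp (1 / 2 * n) ≤ Real.exp (3 / 4 * n) := by
      rw [← Real.exp_add]
      exact Real.exp_le_exp.mpr (by linarith)
    calc Real.exp (1 / 2 * l) * (M * Real.exp (1 / 2 * n)) = M * (Real.exp (1 / 2 * l) * Real.exp (1 / 2 * n)) := by
          ring
      _ ≤ M * Real.exp (3 / 4 * n) := by gcongr
  have t2 : Real.exp (1 / 2 * l) * (Real.exp (3 / 4 * l) * Real.exp (1 / 2 * a) * Real.exp (5 / 4 * (n - l))) ≤
      Real.exp (1 / 2 * a) * Real.exp (5 / 4 * n) := by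
    rw [← Real.exp_add, ← Real.exp_add, ← Real.exp_add, ← Real.exp_add]
    exact Real.exp_le_exp.mpr (by linarith)
  have t3 : Real.exp (1 / 2 * l) * (Real.exp (6 / 5 * a) * Real.exp (1 / 10 * (n - l)) *
      Real.exp (-(2 / 5) * l)) ≤ Real.exp (6 / 5 * a) * Real.exp (1 / 10 * n) := by
    rw [← Real.exp_add, ← Real.exp_add, ← Real.exp_add, ← Real.exp_add]
    exact Real.exp_le_exp.mpr (by linarith)
  have t4 : Real.exp (1 / 2 * l) * (Real.exp (1 / 5 * l) * Real.exp (6 / 5 * a) * Real.exp (7 / 10 * (n - l))) ≤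
      Real.exp (6 / 5 * a) * Real.exp (7 / 10 * n) := by
    rw [← Real.exp_add, ← Real.exp_add, ← Real.exp_add, ← Real.exp_add]
    exact Real.exp_le_exp.mpr (by linarith)
  have t5 : Real.exp (1 / 2 * l) * (Real.exp (1 / 2 * l) * Real.exp (3 / 5 * a) * Real.exp (13 / 10 * (n - l))) ≤
      Real.exp (3 / 5 * a) * Real.exp (13 / 10 * n) := by
    rw [← Real.exp_add, ← Real.exp_add, ← Real.exp_add, ← Real.exp_add]
    exact Real.exp_le_exp.mpr (by linarith)
  have t6 : Real.exp (1 / 2 * l) * (Real.exp (1 / 2 * l) * Real.exp (7 / 4 * (n - l))) ≤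
      Real.exp (7 / 4 * n) := by
    rw [← Real.exp_add, ← Real.exp_add]
    exact Real.exp_le_exp.mpr (by linarith)
  linarith [t1, t2, t3, t4, t5, t6]

/-- **The absorptions of §6** ("`M^{6/5}N^{1/10} ≪ MN^{3/4}` if `M ≪ N²`", and
`M^{1/2}N^{5/4} ≪ MN^{3/4} + N^{7/4}`): for `M > 0`, `N ≥ 1/2` and `M ≤ 4N²`,
`MN^{3/4} + M^{1/2}N^{5/4} + M^{6/5}N^{1/10} + M^{6/5}N^{7/10} + M^{3/5}N^{13/10} + N^{7/4}
  ≤ 5 (MN^{3/4} + N^{7/4} + M^{6/5}N^{7/10} + M^{3/5}N^{13/10})`. [cite: BettinChandee2018, §6] -/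
theorem BC_terms6_absorb {M N : ℝ} (hM : 0 < M) (hN : 1 / 2 ≤ N) (hMN : M ≤ 4 * N ^ 2) :
    M * N ^ (3 / 4 : ℝ) + M ^ (1 / 2 : ℝ) * N ^ (5 / 4 : ℝ) + M ^ (6 / 5 : ℝ) * N ^ (1 / 10 : ℝ) +
        M ^ (6 / 5 : ℝ) * N ^ (7 / 10 : ℝ) + M ^ (3 / 5 : ℝ) * N ^ (13 / 10 : ℝ) + N ^ (7 / 4 : ℝ) ≤
      5 * (M * N ^ (3 / 4 : ℝ) + N ^ (7 / 4 : ℝ) + M ^ (6 / 5 : ℝ) * N ^ (7 / 10 : ℝ) +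
        M ^ (3 / 5 : ℝ) * N ^ (13 / 10 : ℝ)) := by
  have hN0 : 0 < N := by linarith
  obtain ⟨a, ha⟩ : ∃ a : ℝ, a = Real.log M := ⟨_, rfl⟩
  obtain ⟨n, hn⟩ : ∃ n : ℝ, n = Real.log N := ⟨_, rfl⟩
  have hlog2 : Real.log 2 < 0.6931471808 := Real.log_two_lt_d9
  have hn0 : -Real.log 2 ≤ n := by
    have h1 : Real.log (1 / 2) ≤ Real.log N := Real.log_le_log (by norm_num) hN
    rw [Real.log_div one_ne_zero two_ne_zero, Real.log_one, zero_sub, ← hn] at h1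
    exact h1
  have han : a ≤ 2 * n + Real.log 4 := by
    have h1 : Real.log M ≤ Real.log (4 * N ^ 2) := Real.log_le_log hM hMN
    rw [Real.log_mul (by norm_num) (by positivity), Real.log_pow, ← ha, ← hn] at h1
    push_cast at h1
    linarith
  have hlog4 : Real.log 4 = 2 * Real.log 2 := by
    rw [show (4 : ℝ) = 2 ^ 2 by norm_num, Real.log_pow]; push_cast; ring
  have eM : ∀ c : ℝ, M ^ c = Real.exp (c * a) := fun c => by
    rw [Real.rpow_def_of_pos hM, mul_comm, ha]
  have eN : ∀ c : ℝ, N ^ c = Real.exp (c * n) := fun c => by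
    rw [Real.rpow_def_of_pos hN0, mul_comm, hn]
  have eM1 : M = Real.exp a := by rw [ha, Real.exp_log hM]
  -- `M^{1/2}N^{5/4} ≤ MN^{3/4} + N^{7/4}` (the exponent is the average)
  have h2 : M ^ (1 / 2 : ℝ) * N ^ (5 / 4 : ℝ) ≤ M * N ^ (3 / 4 : ℝ) + N ^ (7 / 4 : ℝ) := by
    rw [eM, eN, eM1, eN, eN, ← Real.exp_add, ← Real.exp_add]
    rcases le_total (a + 3 / 4 * n) (7 / 4 * n) with h | h
    · have : Real.exp (1 / 2 * a + 5 / 4 * n) ≤ Real.exp (7 / 4 * n) := Real.exp_le_exp.mpr (by linarith)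
      linarith [Real.exp_pos (a + 3 / 4 * n)]
    · have : Real.exp (1 / 2 * a + 5 / 4 * n) ≤ Real.exp (a + 3 / 4 * n) := Real.exp_le_exp.mpr (by linarith)
      linarith [Real.exp_pos (7 / 4 * n)]
  -- `M^{6/5}N^{1/10} ≤ 3 MN^{3/4}` when `M ≤ 4N²`, `N ≥ 1/2`
  have h3 : M ^ (6 / 5 : ℝ) * N ^ (1 / 10 : ℝ) ≤ 3 * (M * N ^ (3 / 4 : ℝ)) := by
    rw [eM, eN, eM1, eN, ← Real.exp_add, ← Real.exp_add]
    have hexp1 : Real.exp 1 ≤ 3 := by have := Real.exp_one_lt_d9; linarith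
    calc Real.exp (6 / 5 * a + 1 / 10 * n) ≤ Real.exp (1 + (a + 3 / 4 * n)) :=
          Real.exp_le_exp.mpr (by linarith)
      _ = Real.exp 1 * Real.exp (a + 3 / 4 * n) := Real.exp_add _ _
      _ ≤ 3 * Real.exp (a + 3 / 4 * n) := by gcongr
  have p1 : 0 ≤ M * N ^ (3 / 4 : ℝ) := by positivity
  have p2 : 0 ≤ N ^ (7 / 4 : ℝ) := by positivity
  have p3 : 0 ≤ M ^ (6 / 5 : ℝ) * N ^ (7 / 10 : ℝ) := by positivity
  have p4 : 0 ≤ M ^ (3 / 5 : ℝ) * N ^ (13 / 10 : ℝ) := by positivity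
  linarith

/-! ### From (5.2) to (6.4) -/

/-- **One squarefull `b`** (the two cases `b ≤ N^{1/2}` — hypothesis (5.2) at `N' = N/b` — and
`b > N^{1/2}` — the trivial bound — of Bettin–Chandee §6): for `γ` supported where
`γ_{n'} ≠ 0 ⇒ n'` squarefree, `(n', b) = 1`, `β_{bn'} ≠ 0` (e.g. `γ = β_b`),
`b^{1/2} ∑_{M<m≤2M,(m,b)=1} |kfInner k b (N/b) γ m|² ≤ ‖γ‖² (K (MN(1+|k|))^ε (1+|k|/MN)^{1/2} T₆(M,N) + 4MN^{3/4})`,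
`T₆ = MN^{3/4} + M^{1/2}N^{5/4} + M^{6/5}N^{1/10} + M^{6/5}N^{7/10} + M^{3/5}N^{13/10} + N^{7/4}`.
[cite: BettinChandee2018, §6 (6.1)–(6.2)] -/
theorem BC_sqrtb_Cb_le {ε K M N : ℝ} (hK : 0 < K) (hM : 1 / 2 ≤ M) (hN : 1 / 2 ≤ N)
    {k : ℤ} (hk : k ≠ 0) {β : ℕ → ℂ}
    (hβ : ∀ n : ℕ, β n ≠ 0 → N < n ∧ (n : ℝ) ≤ 2 * N)
    (hβk : ∀ n : ℕ, β n ≠ 0 → n.Coprime k.natAbs)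
    (h5 : ∀ (b : ℕ), 0 < b → (∀ p ∈ b.primeFactors, p ^ 2 ∣ b) →
      ∀ (M N' : ℝ), 1 / 2 ≤ M → 1 / 2 ≤ N' → (b : ℝ) ≤ N' → ∀ (k : ℤ), k ≠ 0 → b.Coprime k.natAbs →
      ∀ (γ : ℕ → ℂ),
        (∀ n : ℕ, γ n ≠ 0 → N' < n ∧ (n : ℝ) ≤ 2 * N') →
        (∀ n : ℕ, γ n ≠ 0 → Squarefree n ∧ n.Coprime b ∧ n.Coprime k.natAbs) →
        ∑ m ∈ (Ioc ⌊M⌋₊ ⌊2 * M⌋₊).filter (fun m => m.Coprime b), ‖kfInner k b N' γ m‖ ^ 2 ≤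
          K * (∑ n ∈ Icc 1 ⌊2 * N'⌋₊, ‖γ n‖ ^ 2) *
          ((b : ℝ) * M * N' * (1 + |(k : ℝ)|)) ^ ε * (1 + |(k : ℝ)| / ((b : ℝ) * N' * M)) ^ (1 / 2 : ℝ) *
          (M * ((b : ℝ) * N') ^ (1 / 2 : ℝ) + (b : ℝ) ^ (3 / 4 : ℝ) * M ^ (1 / 2 : ℝ) * N' ^ (5 / 4 : ℝ) +
            M ^ (6 / 5 : ℝ) * N' ^ (1 / 10 : ℝ) * (b : ℝ) ^ (-(2 / 5) : ℝ) +
            (b : ℝ) ^ (1 / 5 : ℝ) * M ^ (6 / 5 : ℝ) * N' ^ (7 / 10 : ℝ) +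
            (b : ℝ) ^ (1 / 2 : ℝ) * M ^ (3 / 5 : ℝ) * N' ^ (13 / 10 : ℝ) + (b : ℝ) ^ (1 / 2 : ℝ) * N' ^ (7 / 4 : ℝ)))
    {b : ℕ} (hb1 : 1 ≤ b) (hbfull : ∀ p ∈ b.primeFactors, p ^ 2 ∣ b) (γ : ℕ → ℂ)
    (hsupp : ∀ n' : ℕ, γ n' ≠ 0 → Squarefree n' ∧ n'.Coprime b ∧ β (b * n') ≠ 0) :
    Real.sqrt b * ∑ m ∈ (Ioc ⌊M⌋₊ ⌊2 * M⌋₊).filter (fun m => m.Coprime b), ‖kfInner k b (N / b) γ m‖ ^ 2 ≤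
      (∑ n' ∈ Icc 1 ⌊2 * (N / b)⌋₊, ‖γ n'‖ ^ 2) *
        (K * (M * N * (1 + |(k : ℝ)|)) ^ ε * (1 + |(k : ℝ)| / (M * N)) ^ (1 / 2 : ℝ) *
          (M * N ^ (3 / 4 : ℝ) + M ^ (1 / 2 : ℝ) * N ^ (5 / 4 : ℝ) + M ^ (6 / 5 : ℝ) * N ^ (1 / 10 : ℝ) +
            M ^ (6 / 5 : ℝ) * N ^ (7 / 10 : ℝ) + M ^ (3 / 5 : ℝ) * N ^ (13 / 10 : ℝ) + N ^ (7 / 4 : ℝ)) +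
          4 * (M * N ^ (3 / 4 : ℝ))) := by
  have hM0 : 0 < M := by linarith
  have hN0 : 0 < N := by linarith
  have hb0 : 0 < b := hb1
  have hbr : (0 : ℝ) < b := by exact_mod_cast hb0
  have hbr1 : (1 : ℝ) ≤ b := by exact_mod_cast hb1
  have hQ0 : 0 < M * N := mul_pos hM0 hN0
  have hkk0 : 0 < 1 + |(k : ℝ)| := by positivity
  have hW0 : 0 < 1 + |(k : ℝ)| / (M * N) := by positivity
  -- notation for the pieces (opaque abbreviations)
  obtain ⟨nb2, hnb2⟩ : ∃ x : ℝ, x = ∑ n' ∈ Icc 1 ⌊2 * (N / b)⌋₊, ‖γ n'‖ ^ 2 := ⟨_, rfl⟩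
  have hnb0 : 0 ≤ nb2 := by rw [hnb2]; exact Finset.sum_nonneg fun _ _ => sq_nonneg _
  obtain ⟨Cb, hCb⟩ : ∃ x : ℝ,
      x = ∑ m ∈ (Ioc ⌊M⌋₊ ⌊2 * M⌋₊).filter (fun m => m.Coprime b), ‖kfInner k b (N / b) γ m‖ ^ 2 := ⟨_, rfl⟩
  have hCb0 : 0 ≤ Cb := by rw [hCb]; exact Finset.sum_nonneg fun _ _ => sq_nonneg _
  obtain ⟨T6, hT6⟩ : ∃ T6 : ℝ, T6 = M * N ^ (3 / 4 : ℝ) + M ^ (1 / 2 : ℝ) * N ^ (5 / 4 : ℝ) +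
      M ^ (6 / 5 : ℝ) * N ^ (1 / 10 : ℝ) + M ^ (6 / 5 : ℝ) * N ^ (7 / 10 : ℝ) +
      M ^ (3 / 5 : ℝ) * N ^ (13 / 10 : ℝ) + N ^ (7 / 4 : ℝ) := ⟨_, rfl⟩
  have hT60 : 0 ≤ T6 := by
    have p1 : 0 ≤ M * N ^ (3 / 4 : ℝ) := by positivity
    have p2 : 0 ≤ M ^ (1 / 2 : ℝ) * N ^ (5 / 4 : ℝ) := by positivity
    have p3 : 0 ≤ M ^ (6 / 5 : ℝ) * N ^ (1 / 10 : ℝ) := by positivity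
    have p4 : 0 ≤ M ^ (6 / 5 : ℝ) * N ^ (7 / 10 : ℝ) := by positivity
    have p5 : 0 ≤ M ^ (3 / 5 : ℝ) * N ^ (13 / 10 : ℝ) := by positivity
    have p6 : 0 ≤ N ^ (7 / 4 : ℝ) := by positivity
    rw [hT6]; linarith
  obtain ⟨E, hE⟩ : ∃ E : ℝ, E = K * (M * N * (1 + |(k : ℝ)|)) ^ ε * (1 + |(k : ℝ)| / (M * N)) ^ (1 / 2 : ℝ) := ⟨_, rfl⟩
  have hE0 : 0 ≤ E := by rw [hE]; positivity
  have hMN34 : 0 ≤ 4 * (M * N ^ (3 / 4 : ℝ)) := by positivity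
  -- restate the goal with the abbreviations
  suffices hgoal : Real.sqrt b * Cb ≤ nb2 * (E * T6 + 4 * (M * N ^ (3 / 4 : ℝ))) by
    rw [hCb, hnb2, hE, hT6] at hgoal; exact hgoal
  by_cases hsqrtN : (b : ℝ) ≤ N ^ (1 / 2 : ℝ)
  · -- `b ≤ N^{1/2}`: the hypothesis (5.2), unless `γ = 0`
    by_cases hne : ∃ n' : ℕ, γ n' ≠ 0
    · obtain ⟨n₀, hn₀⟩ := hne
      obtain ⟨_, _, hβn₀⟩ := hsupp n₀ hn₀
      have hbk : b.Coprime k.natAbs :=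
        Nat.Coprime.coprime_dvd_left (Dvd.intro _ rfl) (hβk (b * n₀) hβn₀)
      have hNb : 1 / 2 ≤ N / b := by
        have h1 := (hβ (b * n₀) hβn₀).2
        have hn₀1 : (1 : ℝ) ≤ n₀ := by
          have : n₀ ≠ 0 := by
            rintro rfl
            simp only [mul_zero] at hβn₀
            have := (hβ 0 hβn₀).1
            simp at this
            linarith
          exact_mod_cast Nat.one_le_iff_ne_zero.mpr this
        rw [le_div_iff₀ hbr]
        push_cast at h1
        nlinarith
      have hγ1 : ∀ n' : ℕ, γ n' ≠ 0 → N / b < n' ∧ (n' : ℝ) ≤ 2 * (N / b) := by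
        intro n' hn'
        obtain ⟨_, _, hβn'⟩ := hsupp n' hn'
        obtain ⟨h1, h2⟩ := hβ (b * n') hβn'
        push_cast at h1 h2
        constructor
        · rw [div_lt_iff₀ hbr]; linarith
        · rw [show 2 * (N / b) = 2 * N / b by ring, le_div_iff₀ hbr]; linarith
      have hγ2 : ∀ n' : ℕ, γ n' ≠ 0 → Squarefree n' ∧ n'.Coprime b ∧ n'.Coprime k.natAbs := by
        intro n' hn'
        obtain ⟨hsqf, hcop, hβn'⟩ := hsupp n' hn'
        exact ⟨hsqf, hcop, Nat.Coprime.coprime_dvd_left (Dvd.intro_left _ rfl) (hβk (b * n') hβn')⟩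
      have hbN' : (b : ℝ) ≤ N / b := by
        have h2 : (b : ℝ) * b ≤ N := by
          have := mul_le_mul hsqrtN hsqrtN hbr.le (by positivity)
          rwa [← Real.sqrt_eq_rpow, Real.mul_self_sqrt hN0.le] at this
        rw [le_div_iff₀ hbr]; linarith
      have h := h5 b hb0 hbfull M (N / b) hM hNb hbN' k hk hbk γ hγ1 hγ2
      -- simplify `b M (N/b) (1+|k|) = MN(1+|k|)`, `1 + |k|/(b (N/b) M) = 1 + |k|/(MN)`
      have e1 : (b : ℝ) * M * (N / b) * (1 + |(k : ℝ)|) = M * N * (1 + |(k : ℝ)|) := by field_simp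
      have e2 : 1 + |(k : ℝ)| / ((b : ℝ) * (N / b) * M) = 1 + |(k : ℝ)| / (M * N) := by
        rw [mul_div_cancel₀ _ hbr.ne', mul_comm N M]
      rw [e1, e2, ← hnb2, ← hCb] at h
      have h' : Cb ≤ nb2 * E *
          (M * ((b : ℝ) * (N / b)) ^ (1 / 2 : ℝ) + (b : ℝ) ^ (3 / 4 : ℝ) * M ^ (1 / 2 : ℝ) * (N / b) ^ (5 / 4 : ℝ) +
            M ^ (6 / 5 : ℝ) * (N / b) ^ (1 / 10 : ℝ) * (b : ℝ) ^ (-(2 / 5) : ℝ) +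
            (b : ℝ) ^ (1 / 5 : ℝ) * M ^ (6 / 5 : ℝ) * (N / b) ^ (7 / 10 : ℝ) +
            (b : ℝ) ^ (1 / 2 : ℝ) * M ^ (3 / 5 : ℝ) * (N / b) ^ (13 / 10 : ℝ) +
            (b : ℝ) ^ (1 / 2 : ℝ) * (N / b) ^ (7 / 4 : ℝ)) := by
        rw [hE]; calc _ ≤ _ := h
          _ = _ := by ring
      have h52le : Real.sqrt b * (M * ((b : ℝ) * (N / b)) ^ (1 / 2 : ℝ) +
          (b : ℝ) ^ (3 / 4 : ℝ) * M ^ (1 / 2 : ℝ) * (N / b) ^ (5 / 4 : ℝ) +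
          M ^ (6 / 5 : ℝ) * (N / b) ^ (1 / 10 : ℝ) * (b : ℝ) ^ (-(2 / 5) : ℝ) +
          (b : ℝ) ^ (1 / 5 : ℝ) * M ^ (6 / 5 : ℝ) * (N / b) ^ (7 / 10 : ℝ) +
          (b : ℝ) ^ (1 / 2 : ℝ) * M ^ (3 / 5 : ℝ) * (N / b) ^ (13 / 10 : ℝ) +
          (b : ℝ) ^ (1 / 2 : ℝ) * (N / b) ^ (7 / 4 : ℝ)) ≤ T6 := by
        rw [hT6]; exact BC_terms52_le hM0 hN0 hbr1 hsqrtN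
      have hnE : 0 ≤ nb2 * E := mul_nonneg hnb0 hE0
      calc Real.sqrt b * Cb
          ≤ Real.sqrt b * (nb2 * E *
            (M * ((b : ℝ) * (N / b)) ^ (1 / 2 : ℝ) + (b : ℝ) ^ (3 / 4 : ℝ) * M ^ (1 / 2 : ℝ) * (N / b) ^ (5 / 4 : ℝ) +
              M ^ (6 / 5 : ℝ) * (N / b) ^ (1 / 10 : ℝ) * (b : ℝ) ^ (-(2 / 5) : ℝ) +
              (b : ℝ) ^ (1 / 5 : ℝ) * M ^ (6 / 5 : ℝ) * (N / b) ^ (7 / 10 : ℝ) +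
              (b : ℝ) ^ (1 / 2 : ℝ) * M ^ (3 / 5 : ℝ) * (N / b) ^ (13 / 10 : ℝ) +
              (b : ℝ) ^ (1 / 2 : ℝ) * (N / b) ^ (7 / 4 : ℝ))) :=
            mul_le_mul_of_nonneg_left h' (Real.sqrt_nonneg _)
        _ = nb2 * E * (Real.sqrt b *
            (M * ((b : ℝ) * (N / b)) ^ (1 / 2 : ℝ) + (b : ℝ) ^ (3 / 4 : ℝ) * M ^ (1 / 2 : ℝ) * (N / b) ^ (5 / 4 : ℝ) +
              M ^ (6 / 5 : ℝ) * (N / b) ^ (1 / 10 : ℝ) * (b : ℝ) ^ (-(2 / 5) : ℝ) +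
              (b : ℝ) ^ (1 / 5 : ℝ) * M ^ (6 / 5 : ℝ) * (N / b) ^ (7 / 10 : ℝ) +
              (b : ℝ) ^ (1 / 2 : ℝ) * M ^ (3 / 5 : ℝ) * (N / b) ^ (13 / 10 : ℝ) +
              (b : ℝ) ^ (1 / 2 : ℝ) * (N / b) ^ (7 / 4 : ℝ))) := by ring
        _ ≤ nb2 * E * T6 := mul_le_mul_of_nonneg_left h52le hnE
        _ ≤ nb2 * (E * T6 + 4 * (M * N ^ (3 / 4 : ℝ))) := by
            have : 0 ≤ nb2 * (4 * (M * N ^ (3 / 4 : ℝ))) := mul_nonneg hnb0 hMN34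
            nlinarith
    · -- `γ = 0`: the second moment vanishes
      push Not at hne
      have h0 : Cb = 0 := by
        rw [hCb]
        refine Finset.sum_eq_zero fun m _ => ?_
        rw [kfInner_eq_zero_of_forall k b (N / b) (fun n _ => hne n) m, norm_zero]
        simp
      rw [h0, mul_zero]
      exact mul_nonneg hnb0 (add_nonneg (mul_nonneg hE0 hT60) hMN34)
  · -- `b > N^{1/2}`: the trivial bound
    have hbN : N ^ (1 / 2 : ℝ) < b := not_le.mp hsqrtN
    have h1 : Cb ≤ 4 * M * (N / b) * nb2 := by
      rw [hCb, hnb2]; exact kfCI_trivial_bound k b hM0.le (div_pos hN0 hbr).le γ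
    -- `√b · 4M(N/b) = 4MN/√b ≤ 4 M N^{3/4}`
    have hsqb : Real.sqrt b * (4 * M * (N / b)) ≤ 4 * (M * N ^ (3 / 4 : ℝ)) := by
      have hsb : 0 < Real.sqrt b := Real.sqrt_pos.mpr hbr
      have e : Real.sqrt b * (4 * M * (N / b)) = 4 * M * N / Real.sqrt b := by
        rw [eq_div_iff hsb.ne']
        calc Real.sqrt b * (4 * M * (N / b)) * Real.sqrt b = 4 * M * N * (Real.sqrt b * Real.sqrt b / b) := by
              ring
          _ = 4 * M * N := by rw [Real.mul_self_sqrt hbr.le, div_self hbr.ne', mul_one]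
      rw [e, div_le_iff₀ hsb]
      have h2 : N ^ (1 / 4 : ℝ) ≤ Real.sqrt b := by
        rw [Real.sqrt_eq_rpow]
        calc N ^ (1 / 4 : ℝ) = (N ^ (1 / 2 : ℝ)) ^ (1 / 2 : ℝ) := by
              rw [← Real.rpow_mul hN0.le]; norm_num
          _ ≤ (b : ℝ) ^ (1 / 2 : ℝ) := Real.rpow_le_rpow (by positivity) hbN.le (by norm_num)
      have h3 : N = N ^ (3 / 4 : ℝ) * N ^ (1 / 4 : ℝ) := by
        rw [← Real.rpow_add hN0]; norm_num
      calc 4 * M * N = 4 * (M * N ^ (3 / 4 : ℝ)) * N ^ (1 / 4 : ℝ) := by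
            conv_lhs => rw [h3]
            ring
        _ ≤ 4 * (M * N ^ (3 / 4 : ℝ)) * Real.sqrt b := by gcongr
    calc Real.sqrt b * Cb ≤ Real.sqrt b * (4 * M * (N / b) * nb2) :=
          mul_le_mul_of_nonneg_left h1 (Real.sqrt_nonneg _)
      _ = (Real.sqrt b * (4 * M * (N / b))) * nb2 := by ring
      _ ≤ 4 * (M * N ^ (3 / 4 : ℝ)) * nb2 := mul_le_mul_of_nonneg_right hsqb hnb0
      _ ≤ nb2 * (E * T6 + 4 * (M * N ^ (3 / 4 : ℝ))) := by
          have : 0 ≤ nb2 * (E * T6) := mul_nonneg hnb0 (mul_nonneg hE0 hT60)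
          nlinarith

end Literature.NumberTheory.LFunctions

end
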